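import Summits.Schanuel.Schanuel.Theorems.RootDecomp1BQuadFrame05

/-!
# RootDecomp1BQuadFrame — lens 4, generation 36 ADDENDUM «QUADRATIC FRAMES» (B-R23 (ii)(b)): the (1|ρ) At-cells and 5 ≤ polarDeg (1, ρ) for EVERY ρ ∈ `QuadHyperLiouville` (hyper-approximable by real quadratic irrationals) modulo `Roy2014_thm_1_1` ONLY, with the NAMED member ρ_Q = √2 + λ_H of FINITE irrationality exponent — §X EXCLUSION addendum (QuadFrameExcl.lean 6bda9339…: no real algebraic number of degree ≤ 2 is `QuadHyperLiouville`) — continuation (RootDecomp1BQuadFrame06): §X EXCLUSION: Liouville in degree 2 for the class `QuadHyperLiouville`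

(lens-4 g36 `QuadFrameExcl.lean` [HOME/decomp-schanuel-lens-4/g36/ sha256 6bda9339…, 1841 l = the kernel `QuadFrame.lean` ffb0c3af… VERBATIM ll. 1–1513 (= tree parts 01–05) + §X Exclusion ll. 1516–1839; NOTE L1961 — bookkeeping addendum, no credit asked, «PORT optional, census's call»; critic @@ACK@@]; port by census-1 gen 17 as `RootDecomp1BQuadFrame06` importing part 05: §X `not_quadHyperLiouville_of_root (hR : r₂ ≠ 0 ∨ r₁ ≠ 0) (hρ : r₂ρ² + r₁ρ + r₀ = 0) : ¬ QuadHyperLiouville ρ` (Liouville in degree 2 via the norm a²·R(β)·R(β′) ∈ ℤ), corollaries `not_quadHyperLiouville_ratCast`, `not_quadHyperLiouville_of_quadratic`, `not_quadHyperLiouville_sqrt_two`, `QuadHyperLiouville.irrational`, `QuadHyperLiouville.not_quadratic`, `not_quadHyperLiouville_approximant`, `sqrt_two_out_rhoQ_in : ¬ QuadHyperLiouville √2 ∧ QuadHyperLiouville rhoQ` — the degenerate-witness audit of the class (B-g36Q (2), optional item) as a theorem: no β₀ at which L–W gives t(1, β₀) = 4 lies in the class.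
PORT EDITS: the three axiom guards of §X dropped; one docstring; statements and proofs verbatim. `--supports stmt-Schanuel-32406`; no census credit; rung 0.)
-/

noncomputable section

open Complex IntermediateField MvPolynomial

namespace Summit.Schanuel.Schanuel.Theorems.RootDecomp1BQuadFrame

open Summit.Schanuel.Schanuel.Theorems.RootDecomp1EPointTransfer (Roy2014_thm_1_1)
open Summit.Schanuel.Schanuel.Theorems.RootDecomp1KHyper (mvlen mvlen_nonneg abs_coeff_le_mvlen one_le_mvlen
  exists_ball_eval_ne_zero mvlen_add_le mvlen_sub_le mvlen_mul_le mvlen_C_mul_le mvlen_sum_le)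
open Summit.Schanuel.Schanuel.Theorems.RootDecomp1BHyperFrame (royDeg royS RoyNF roy_tree_iff framePt Ff
  Ff_eq_aeval exists_lipschitz_Ff gcoef gcoef_ne_zero apply_zero_le_totalDegree engine_endgame
  trdeg_adjoin_le_of_isAlgebraic' linearIndependent_one_irrational)
open Summit.Schanuel.Schanuel.Theorems.RootDecomp1BFedFlagCore (KleinIH polarDeg polarField)
open Summit.Schanuel.Schanuel.Theorems.RootDecomp1BDefectFloorDefs (SharpRelativeLindemannAt TameDefectZeroAt
  WildSharpDefectZeroAt WildSharpDefectZeroInitAt WildSharpInitAt)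
open Summit.Schanuel.Schanuel.Theorems.RootDecomp1BDefectFloorCells (natCast_le_trdeg_of_algebraicIndependent)
open Summit.Schanuel.Schanuel.Theorems.RootDecomp1BRadicalDescent (exists_int_relation norm_mvaeval_le_mvlen)
open Summit.Schanuel.Schanuel.Theorems.RootDecomp1BMovingZero (mem_polarField_one mem_polarField_swap)

/-! ## §X  EXCLUSION (this file = the kernel `QuadFrame.lean` VERBATIM + this section; HOME-only, not a tree module):
**no real algebraic number of degree ≤ 2 is `QuadHyperLiouville`** — Liouville's inequality in degree 2, made
effective through the NORM `a²·R(β)·R(β′) ∈ ℤ` of the value of `R = r₂Z² + r₁Z + r₀` (the polynomial of `ρ`) at the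
approximant `β` and its conjugate `β′ = −b/a − β`.  Consequences: the class consists of IRRATIONAL, non-quadratic
reals (`QuadHyperLiouville.irrational`, `QuadHyperLiouville.not_quadratic`); the approximants `β` of the class are never
members; `√2 ∉ QuadHyperLiouville` while `ρ_Q = √2 + λ_H ∈ QuadHyperLiouville` (§M).  This is the CONSISTENCY half of
the typing note on `β ≠ ρ` (critic's checklist B-g36Q (2), optional item): at a real quadratic irrational `β₀`,
Lindemann–Weierstrass gives `t(1, β₀) = 4`, so `five_le_polarDeg_one_of_quadHyper` would REFUTE `Roy2014_thm_1_1` if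
`β₀` were in the class — and it is not, unconditionally. -/

section Exclusion

/-- `exp(−x) < 1/x` for `0 < x`. -/
private theorem exp_neg_lt_one_div_X {x : ℝ} (hx : 0 < x) : Real.exp (-x) < 1 / x := by
  rw [Real.exp_neg, ← one_div]
  apply one_div_lt_one_div_of_lt hx
  linarith [Real.add_one_le_exp x]

/-- A positive integer-valued real is `≥ 1`. -/
private theorem one_le_of_int_pos {z : ℤ} {x : ℝ} (hx : x = (z : ℝ)) (hpos : 0 < x) : 1 ≤ x := by
  have hz : 0 < z := by exact_mod_cast (hx ▸ hpos)
  rw [hx]; exact_mod_cast hz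

/-- **Liouville in degree 2: a real root of a non-zero integer polynomial of degree `≤ 2` is NOT
`QuadHyperLiouville`.**  (So the class contains no rational and no real quadratic irrational — consistent with
Lindemann–Weierstrass, which gives `t(1, β) = 4 < 5` at such points.) -/
theorem not_quadHyperLiouville_of_root {ρ : ℝ} {r₂ r₁ r₀ : ℤ} (hR : r₂ ≠ 0 ∨ r₁ ≠ 0)
    (hρ : (r₂ : ℝ) * ρ ^ 2 + r₁ * ρ + r₀ = 0) : ¬ QuadHyperLiouville ρ := by
  intro h
  -- the height `H = |r₂| + |r₁| + |r₀| ≥ 1` and the constant of the generic case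
  set Hr : ℝ := |(r₂ : ℝ)| + |(r₁ : ℝ)| + |(r₀ : ℝ)| with hHr
  have hH1 : 1 ≤ Hr := by
    rcases hR with h2 | h1
    · have : (1 : ℝ) ≤ |(r₂ : ℝ)| := by
        rw [← Int.cast_abs]; exact_mod_cast Int.one_le_abs h2
      rw [hHr]; linarith [abs_nonneg (r₁ : ℝ), abs_nonneg (r₀ : ℝ)]
    · have : (1 : ℝ) ≤ |(r₁ : ℝ)| := by
        rw [← Int.cast_abs]; exact_mod_cast Int.one_le_abs h1
      rw [hHr]; linarith [abs_nonneg (r₂ : ℝ), abs_nonneg (r₀ : ℝ)]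
  have hH0 : 0 < Hr := by linarith
  have hr2H : |(r₂ : ℝ)| ≤ Hr := by rw [hHr]; linarith [abs_nonneg (r₁ : ℝ), abs_nonneg (r₀ : ℝ)]
  have hr1H : |(r₁ : ℝ)| ≤ Hr := by rw [hHr]; linarith [abs_nonneg (r₂ : ℝ), abs_nonneg (r₀ : ℝ)]
  have hr0H : |(r₀ : ℝ)| ≤ Hr := by rw [hHr]; linarith [abs_nonneg (r₂ : ℝ), abs_nonneg (r₁ : ℝ)]
  obtain ⟨M₀, hM₀⟩ := exists_nat_ge (Hr ^ 2 * (2 * |ρ| + 2) * (|ρ| + 3) ^ 2 + Hr)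
  obtain ⟨β, a, b, c, A, hmA, hirr, ha0, hβ, haA, hbA, hcA, hne, hdist⟩ := h (M₀ + 6)
  -- sizes of `A`, `m`
  have hcpos : (0 : ℝ) ≤ Hr ^ 2 * (2 * |ρ| + 2) * (|ρ| + 3) ^ 2 := by positivity
  have hHM : Hr ≤ M₀ := le_trans (le_add_of_nonneg_left hcpos) hM₀
  have hcM : Hr ^ 2 * (2 * |ρ| + 2) * (|ρ| + 3) ^ 2 ≤ M₀ := le_trans (by linarith) hM₀
  have hmA' : (M₀ : ℝ) + 6 ≤ A := by exact_mod_cast hmA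
  have hA1 : (1 : ℝ) ≤ A := by linarith [(Nat.cast_nonneg M₀ : (0 : ℝ) ≤ M₀)]
  have hA0 : (0 : ℝ) < A := by linarith
  have haR : (1 : ℝ) ≤ |(a : ℝ)| := by rw [← Int.cast_abs]; exact_mod_cast Int.one_le_abs ha0
  have haA' : |(a : ℝ)| ≤ A := by rw [← Int.cast_abs]; exact_mod_cast haA
  have hbA' : |(b : ℝ)| ≤ A := by rw [← Int.cast_abs]; exact_mod_cast hbA
  have ha0R : (a : ℝ) ≠ 0 := by exact_mod_cast ha0
  -- `|ρ − β| < 1/A^m ≤ 1/A^2 ≤ 1/A`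
  have hpowpos : (0 : ℝ) < (A : ℝ) ^ (M₀ + 6) := by positivity
  have hd : |ρ - β| < 1 / (A : ℝ) ^ (M₀ + 6) := hdist.trans (exp_neg_lt_one_div_X hpowpos)
  have hdpos : 0 < |ρ - β| := abs_pos.mpr (sub_ne_zero.mpr (Ne.symm hne))
  have hβle : |β| ≤ |ρ| + 1 := by
    have h1 : |ρ - β| < 1 := by
      refine hd.trans_le ?_
      rw [div_le_one hpowpos]; exact one_le_pow₀ hA1
    have := abs_sub_abs_le_abs_sub β ρ
    rw [abs_sub_comm] at this
    linarith
  -- the conjugate `β'` and the symmetric functions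
  set β' : ℝ := -(b : ℝ) / a - β with hβ'
  have hsum : β + β' = -(b : ℝ) / a := by rw [hβ']; ring
  have hprod : β * β' = (c : ℝ) / a := by
    rw [hβ']; field_simp; linear_combination -hβ
  have hβ'le : |β'| ≤ A + |ρ| + 1 := by
    have h1 : |(-(b : ℝ)) / a| ≤ A := by
      rw [abs_div, abs_neg, div_le_iff₀ (by linarith)]
      exact hbA'.trans (le_mul_of_one_le_right hA0.le haR)
    calc |β'| = |-(b : ℝ) / a - β| := by rw [hβ']
      _ ≤ |-(b : ℝ) / a| + |β| := abs_sub _ _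
      _ ≤ A + (|ρ| + 1) := add_le_add h1 hβle
      _ = A + |ρ| + 1 := by ring
  -- the values `R(β)`, `R(β')` and the NORM `a² R(β) R(β') ∈ ℤ`
  set Rβ : ℝ := (r₂ : ℝ) * β ^ 2 + r₁ * β + r₀ with hRβ
  set Rβ' : ℝ := (r₂ : ℝ) * β' ^ 2 + r₁ * β' + r₀ with hRβ'
  set Nz : ℤ := r₂ ^ 2 * c ^ 2 - r₂ * r₁ * b * c + r₂ * r₀ * (b ^ 2 - 2 * a * c) + r₁ ^ 2 * a * c
    - r₁ * r₀ * a * b + r₀ ^ 2 * a ^ 2 with hNz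
  have hsymm : Rβ * Rβ' = (r₂ : ℝ) ^ 2 * (β * β') ^ 2 + r₂ * r₁ * (β * β') * (β + β')
      + r₂ * r₀ * ((β + β') ^ 2 - 2 * (β * β')) + r₁ ^ 2 * (β * β') + r₁ * r₀ * (β + β') + r₀ ^ 2 := by
    rw [hRβ, hRβ']; ring
  have hnorm : (a : ℝ) ^ 2 * (Rβ * Rβ') = (Nz : ℝ) := by
    rw [hsymm, hsum, hprod, hNz]; push_cast; field_simp; ring
  -- the difference `R(β) − R(ρ) = (β − ρ)(r₂(β + ρ) + r₁)`
  have hdiff : Rβ = (β - ρ) * ((r₂ : ℝ) * (β + ρ) + r₁) := by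
    rw [hRβ]; linear_combination hρ
  have hlin : |(r₂ : ℝ) * (β + ρ) + r₁| ≤ Hr * (2 * |ρ| + 2) := by
    calc |(r₂ : ℝ) * (β + ρ) + r₁| ≤ |(r₂ : ℝ) * (β + ρ)| + |(r₁ : ℝ)| := abs_add_le _ _
      _ = |(r₂ : ℝ)| * |β + ρ| + |(r₁ : ℝ)| := by rw [abs_mul]
      _ ≤ |(r₂ : ℝ)| * (|ρ| + 1 + |ρ|) + |(r₁ : ℝ)| := by
          gcongr
          exact (abs_add_le _ _).trans (by linarith)
      _ ≤ Hr * (|ρ| + 1 + |ρ|) + Hr := by gcongr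
      _ = Hr * (2 * |ρ| + 2) := by ring
  have hRβle : |Rβ| ≤ |ρ - β| * (Hr * (2 * |ρ| + 2)) := by
    rw [hdiff, abs_mul, abs_sub_comm]
    exact mul_le_mul_of_nonneg_left hlin (abs_nonneg _)
  have hRβ'le : |Rβ'| ≤ Hr * (A + |ρ| + 2) ^ 2 := by
    have h1 : |β'| ^ 2 + |β'| + 1 ≤ (A + |ρ| + 2) ^ 2 := by
      have h2 : |β'| ^ 2 ≤ ((A : ℝ) + |ρ| + 1) ^ 2 := pow_le_pow_left₀ (abs_nonneg _) hβ'le 2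
      have e : ((A : ℝ) + |ρ| + 2) ^ 2 = ((A : ℝ) + |ρ| + 1) ^ 2 + 2 * ((A : ℝ) + |ρ| + 1) + 1 := by ring
      rw [e]; linarith [abs_nonneg β', abs_nonneg ρ]
    calc |Rβ'| ≤ |(r₂ : ℝ) * β' ^ 2 + (r₁ : ℝ) * β'| + |(r₀ : ℝ)| := by rw [hRβ']; exact abs_add_le _ _
      _ ≤ |(r₂ : ℝ) * β' ^ 2| + |(r₁ : ℝ) * β'| + |(r₀ : ℝ)| := by
          gcongr; exact abs_add_le _ _
      _ = |(r₂ : ℝ)| * |β'| ^ 2 + |(r₁ : ℝ)| * |β'| + |(r₀ : ℝ)| := by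
          rw [abs_mul, abs_mul, abs_pow]
      _ ≤ Hr * |β'| ^ 2 + Hr * |β'| + Hr := by gcongr
      _ = Hr * (|β'| ^ 2 + |β'| + 1) := by ring
      _ ≤ Hr * (A + |ρ| + 2) ^ 2 := mul_le_mul_of_nonneg_left h1 hH0.le
  -- power bookkeeping: `1/A^m ≤ 1/A^2 ≤ 1/A`, and `A^4 · (1/A^m) ≤ 1/A`
  have hAm_ge_A2 : (A : ℝ) ^ 2 ≤ (A : ℝ) ^ (M₀ + 6) := pow_le_pow_right₀ hA1 (by omega)
  have hAm_ge_A5 : (A : ℝ) ^ 5 ≤ (A : ℝ) ^ (M₀ + 6) := pow_le_pow_right₀ hA1 (by omega)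
  have hd2 : |ρ - β| < 1 / (A : ℝ) ^ 2 := hd.trans_le (one_div_le_one_div_of_le (by positivity) hAm_ge_A2)
  have hd1 : |ρ - β| < 1 / (A : ℝ) := by
    refine hd2.trans_le (one_div_le_one_div_of_le hA0 ?_)
    rw [sq]; exact le_mul_of_one_le_right hA0.le hA1
  by_cases hN : Nz = 0
  · -- DEGENERATE case: `R(β) = 0` or `R(β') = 0`
    have hzero : Rβ * Rβ' = 0 := by
      have h1 : (a : ℝ) ^ 2 * (Rβ * Rβ') = 0 := by rw [hnorm, hN, Int.cast_zero]
      rcases mul_eq_zero.mp h1 with h2 | h2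
      · exact absurd ((pow_eq_zero_iff two_ne_zero).mp h2) ha0R
      · exact h2
    rcases mul_eq_zero.mp hzero with hRβ0 | hRβ'0
    · -- (i) `R(β) = 0 = R(ρ)`, `β ≠ ρ`: `r₂ ≠ 0`, `r₂²(β − ρ)² = r₁² − 4 r₂ r₀ ≥ 1`
      have hfac : (r₂ : ℝ) * (β + ρ) + r₁ = 0 := by
        have h1 : (β - ρ) * ((r₂ : ℝ) * (β + ρ) + r₁) = 0 := by rw [← hdiff]; exact hRβ0
        rcases mul_eq_zero.mp h1 with h2 | h2
        · exact absurd (sub_eq_zero.mp h2) hne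
        · exact h2
      have hr2 : r₂ ≠ 0 := by
        rcases hR with h2 | h1
        · exact h2
        · intro h2
          rw [h2, Int.cast_zero, zero_mul, zero_add] at hfac
          exact h1 (by exact_mod_cast hfac)
      have hr2R0 : (r₂ : ℝ) ≠ 0 := by exact_mod_cast hr2
      have hΔ : (r₂ : ℝ) ^ 2 * (β - ρ) ^ 2 = ((r₁ ^ 2 - 4 * r₂ * r₀ : ℤ) : ℝ) := by
        push_cast
        have hRβ0' : (r₂ : ℝ) * β ^ 2 + r₁ * β + r₀ = 0 := hRβ0
        linear_combination (4 * (r₂ : ℝ)) * hRβ0' + ((r₂ : ℝ) * (ρ - 3 * β) - r₁) * hfac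
      have hΔ1 : 1 ≤ (r₂ : ℝ) ^ 2 * (β - ρ) ^ 2 :=
        one_le_of_int_pos hΔ (lt_of_le_of_ne (by positivity)
          (mul_ne_zero (pow_ne_zero 2 hr2R0) (pow_ne_zero 2 (sub_ne_zero.mpr hne))).symm)
      -- `|β − ρ| ≥ 1/|r₂| ≥ 1/Hr ≥ 1/M₀ > 1/A`
      have hkey : 1 ≤ Hr ^ 2 * |ρ - β| ^ 2 := by
        have h1 : (r₂ : ℝ) ^ 2 ≤ Hr ^ 2 := by
          rw [← sq_abs]; exact pow_le_pow_left₀ (abs_nonneg _) hr2H 2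
        have h2 : (β - ρ) ^ 2 = |ρ - β| ^ 2 := by rw [sq_abs, ← neg_sub, neg_sq]
        have h3 := mul_le_mul_of_nonneg_right h1 (sq_nonneg (β - ρ))
        rw [h2] at h3 hΔ1; linarith
      have hlt : Hr * |ρ - β| < 1 := by
        calc Hr * |ρ - β| < Hr * (1 / A) := mul_lt_mul_of_pos_left hd1 hH0
          _ ≤ 1 := by
            rw [mul_one_div, div_le_one hA0]; linarith
      have hsq : (Hr * |ρ - β|) ^ 2 < 1 := pow_lt_one₀ (mul_nonneg hH0.le hdpos.le) hlt two_ne_zero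
      have e : (Hr * |ρ - β|) ^ 2 = Hr ^ 2 * |ρ - β| ^ 2 := by ring
      linarith
    · by_cases hρβ' : β' = ρ
      · -- (ii-a) `ρ = β'`: `a²(β − β')² = b² − 4ac ≥ 1`, so `|ρ − β| ≥ 1/|a| ≥ 1/A`
        have hdisc : (a : ℝ) ^ 2 * (β - β') ^ 2 = ((b ^ 2 - 4 * a * c : ℤ) : ℝ) := by
          push_cast
          have h1 : (β - β') ^ 2 = (β + β') ^ 2 - 4 * (β * β') := by ring
          rw [h1, hsum, hprod]; field_simp
        have hdisc1 : 1 ≤ (a : ℝ) ^ 2 * (β - β') ^ 2 := by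
          have hββ' : β - β' ≠ 0 := by rw [hρβ']; exact sub_ne_zero.mpr hne
          exact one_le_of_int_pos hdisc (lt_of_le_of_ne (by positivity)
            (mul_ne_zero (pow_ne_zero 2 ha0R) (pow_ne_zero 2 hββ')).symm)
        have hkey : 1 ≤ (A : ℝ) ^ 2 * |ρ - β| ^ 2 := by
          have h1 : (a : ℝ) ^ 2 ≤ (A : ℝ) ^ 2 := by
            rw [← sq_abs]; exact pow_le_pow_left₀ (abs_nonneg _) haA' 2
          have h2 : (β - β') ^ 2 = |ρ - β| ^ 2 := by rw [hρβ', sq_abs, ← neg_sub, neg_sq]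
          have h3 := mul_le_mul_of_nonneg_right h1 (sq_nonneg (β - β'))
          rw [h2] at h3 hdisc1; linarith
        have hlt : (A : ℝ) * |ρ - β| < 1 := by
          calc (A : ℝ) * |ρ - β| < A * (1 / A) := mul_lt_mul_of_pos_left hd1 hA0
            _ = 1 := by field_simp
        have hsq : ((A : ℝ) * |ρ - β|) ^ 2 < 1 := pow_lt_one₀ (mul_nonneg hA0.le hdpos.le) hlt two_ne_zero
        have e : ((A : ℝ) * |ρ - β|) ^ 2 = (A : ℝ) ^ 2 * |ρ - β| ^ 2 := by ring
        linarith
      · -- (ii-b) `R(β') = 0 = R(ρ)`, `β' ≠ ρ`: `ρ − β = b/a − r₁/r₂ − … ` is a non-zero rational of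
        -- denominator `≤ |a r₂| ≤ A·Hr`
        have hdiff' : Rβ' = (β' - ρ) * ((r₂ : ℝ) * (β' + ρ) + r₁) := by
          rw [hRβ']; linear_combination hρ
        have hfac : (r₂ : ℝ) * (β' + ρ) + r₁ = 0 := by
          have h1 : (β' - ρ) * ((r₂ : ℝ) * (β' + ρ) + r₁) = 0 := by rw [← hdiff']; exact hRβ'0
          rcases mul_eq_zero.mp h1 with h2 | h2
          · exact absurd (sub_eq_zero.mp h2) hρβ'
          · exact h2
        have hr2 : r₂ ≠ 0 := by
          rcases hR with h2 | h1
          · exact h2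
          · intro h2
            rw [h2, Int.cast_zero, zero_mul, zero_add] at hfac
            exact h1 (by exact_mod_cast hfac)
        have hr2R0 : (r₂ : ℝ) ≠ 0 := by exact_mod_cast hr2
        -- `a r₂ (ρ − β) = b r₂ − a r₁ + … ` : precisely `a·r₂·(ρ − β) = -(b r₂) - a r₁ + … `
        have hrat : (a : ℝ) * r₂ * (ρ - β) = ((b * r₂ - a * r₁ : ℤ) : ℝ) := by
          push_cast
          have hρeq : ρ = -(r₁ : ℝ) / r₂ - β' := by field_simp; linear_combination hfac
          rw [hρeq, hβ']; field_simp; ring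
        have hnum : (b * r₂ - a * r₁ : ℤ) ≠ 0 := by
          intro h0
          rw [h0, Int.cast_zero] at hrat
          rcases mul_eq_zero.mp hrat with h1 | h1
          · rcases mul_eq_zero.mp h1 with h2 | h2
            · exact ha0R h2
            · exact hr2R0 h2
          · exact hne (sub_eq_zero.mp h1).symm
        have h1le : (1 : ℝ) ≤ |(a : ℝ) * r₂ * (ρ - β)| := by
          rw [hrat, ← Int.cast_abs]; exact_mod_cast Int.one_le_abs hnum
        rw [abs_mul, abs_mul] at h1le
        -- `1 ≤ |a||r₂||ρ−β| ≤ A · Hr · |ρ − β| < A · Hr / A² ≤ Hr / A ≤ 1`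
        have h2 : |(a : ℝ)| * |(r₂ : ℝ)| * |ρ - β| ≤ A * Hr * |ρ - β| := by
          gcongr
        have h3 : (A : ℝ) * Hr * |ρ - β| < A * Hr * (1 / (A : ℝ) ^ 2) :=
          mul_lt_mul_of_pos_left hd2 (by positivity)
        have h4 : (A : ℝ) * Hr * (1 / (A : ℝ) ^ 2) = Hr / A := by field_simp
        have h5 : Hr / A ≤ 1 := by rw [div_le_one hA0]; linarith
        linarith
  · -- GENERIC case: `|Nz| ≥ 1`
    have hN1 : (1 : ℝ) ≤ |(a : ℝ) ^ 2 * (Rβ * Rβ')| := by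
      rw [hnorm, ← Int.cast_abs]; exact_mod_cast Int.one_le_abs hN
    rw [abs_mul, abs_mul, abs_pow] at hN1
    -- `1 ≤ A² · |ρ−β| Hr (2|ρ|+2) · Hr (A+|ρ|+2)²`
    have h1 : |(a : ℝ)| ^ 2 * (|Rβ| * |Rβ'|) ≤
        (A : ℝ) ^ 2 * ((|ρ - β| * (Hr * (2 * |ρ| + 2))) * (Hr * (A + |ρ| + 2) ^ 2)) := by
      gcongr
    -- `(A + |ρ| + 2)² ≤ A² (|ρ|+3)²`
    have h2 : ((A : ℝ) + |ρ| + 2) ^ 2 ≤ (A : ℝ) ^ 2 * (|ρ| + 3) ^ 2 := by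
      rw [← mul_pow]; apply pow_le_pow_left₀ (by positivity)
      have e : (A : ℝ) * (|ρ| + 3) = ((A : ℝ) + |ρ| + 2) + ((A : ℝ) - 1) * |ρ| + 2 * ((A : ℝ) - 1) := by ring
      rw [e]; linarith [mul_nonneg (sub_nonneg.mpr hA1) (abs_nonneg ρ)]
    have h3 : (1 : ℝ) ≤ (A : ℝ) ^ 4 * |ρ - β| * (Hr ^ 2 * (2 * |ρ| + 2) * (|ρ| + 3) ^ 2) := by
      have h6 := hN1.trans h1
      have hcoef : (0 : ℝ) ≤ (A : ℝ) ^ 2 * (|ρ - β| * (Hr * (2 * |ρ| + 2))) * Hr := by positivity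
      have h7 := mul_le_mul_of_nonneg_left h2 hcoef
      have e1 : (A : ℝ) ^ 2 * ((|ρ - β| * (Hr * (2 * |ρ| + 2))) * (Hr * (A + |ρ| + 2) ^ 2)) =
          (A : ℝ) ^ 2 * (|ρ - β| * (Hr * (2 * |ρ| + 2))) * Hr * ((A : ℝ) + |ρ| + 2) ^ 2 := by ring
      have e2 : (A : ℝ) ^ 4 * |ρ - β| * (Hr ^ 2 * (2 * |ρ| + 2) * (|ρ| + 3) ^ 2) =
          (A : ℝ) ^ 2 * (|ρ - β| * (Hr * (2 * |ρ| + 2))) * Hr * ((A : ℝ) ^ 2 * (|ρ| + 3) ^ 2) := by ring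
      rw [e1] at h6; rw [e2]; linarith
    -- `A⁴ |ρ − β| < A⁴ / A^m ≤ 1/A`
    have h4 : (A : ℝ) ^ 4 * |ρ - β| < 1 / A := by
      calc (A : ℝ) ^ 4 * |ρ - β| < (A : ℝ) ^ 4 * (1 / (A : ℝ) ^ (M₀ + 6)) :=
            mul_lt_mul_of_pos_left hd (by positivity)
        _ ≤ (A : ℝ) ^ 4 * (1 / (A : ℝ) ^ 5) :=
            mul_le_mul_of_nonneg_left (one_div_le_one_div_of_le (by positivity) hAm_ge_A5) (by positivity)
        _ = 1 / A := by field_simp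
    have h5 : (1 : ℝ) / A * (Hr ^ 2 * (2 * |ρ| + 2) * (|ρ| + 3) ^ 2) < 1 := by
      rw [div_mul_eq_mul_div, one_mul, div_lt_one hA0]; linarith
    linarith [mul_le_mul_of_nonneg_right h4.le hcpos]

/-- No RATIONAL number is `QuadHyperLiouville`. -/
theorem not_quadHyperLiouville_ratCast (r : ℚ) : ¬ QuadHyperLiouville (r : ℝ) :=
  not_quadHyperLiouville_of_root (r₂ := 0) (r₁ := (r.den : ℤ)) (r₀ := -r.num)
    (Or.inr (by exact_mod_cast r.den_nz)) (by
      push_cast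
      have := Rat.num_div_den r
      have hd : (r.den : ℝ) ≠ 0 := by exact_mod_cast r.den_nz
      rw [zero_mul, zero_add]
      have h1 : ((r.den : ℤ) : ℝ) * (r : ℝ) = (r.num : ℝ) := by
        have h2 : (r : ℝ) = (r.num : ℝ) / (r.den : ℝ) := by exact_mod_cast this.symm
        rw [h2]; push_cast; field_simp
      push_cast at h1
      linarith)

/-- No real QUADRATIC IRRATIONAL (indeed no real root of `aZ² + bZ + c`, `a ≠ 0`) is `QuadHyperLiouville` —
in particular the approximants `β` of the class are never members, and `√2 ∉ QuadHyperLiouville`. -/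
theorem not_quadHyperLiouville_of_quadratic {ρ : ℝ} {a b c : ℤ} (ha : a ≠ 0)
    (hρ : (a : ℝ) * ρ ^ 2 + b * ρ + c = 0) : ¬ QuadHyperLiouville ρ :=
  not_quadHyperLiouville_of_root (Or.inl ha) hρ

/-- `√2 ∉ QuadHyperLiouville` (Liouville in degree 2). -/
theorem not_quadHyperLiouville_sqrt_two : ¬ QuadHyperLiouville (Real.sqrt 2) :=
  not_quadHyperLiouville_of_quadratic (a := 1) (b := 0) (c := -2) one_ne_zero (by
    have h := Real.sq_sqrt (show (0 : ℝ) ≤ 2 by norm_num)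
    push_cast; linarith)

/-- Members of the class are irrational … -/
theorem QuadHyperLiouville.irrational {ρ : ℝ} (h : QuadHyperLiouville ρ) : Irrational ρ := by
  rintro ⟨r, hr⟩
  rw [← hr] at h
  exact not_quadHyperLiouville_ratCast r h

/-- … and satisfy no quadratic (or linear) integer equation. -/
theorem QuadHyperLiouville.not_quadratic {ρ : ℝ} (h : QuadHyperLiouville ρ) {a b c : ℤ} (ha : a ≠ 0 ∨ b ≠ 0) :
    (a : ℝ) * ρ ^ 2 + b * ρ + c ≠ 0 :=
  fun hρ => not_quadHyperLiouville_of_root ha hρ h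

/-- The approximants of a member are never members: if `β` is one of the quadratic irrationals of the definition
(`aβ² + bβ + c = 0`, `a ≠ 0`), then `¬ QuadHyperLiouville β`. -/
theorem not_quadHyperLiouville_approximant {β : ℝ} {a b c : ℤ} (ha : a ≠ 0)
    (hβ : (a : ℝ) * β ^ 2 + b * β + c = 0) : ¬ QuadHyperLiouville β :=
  not_quadHyperLiouville_of_quadratic ha hβ

/-- CONTRAST: `√2 ∉ QuadHyperLiouville` but `ρ_Q = √2 + λ_H ∈ QuadHyperLiouville`. -/
theorem sqrt_two_out_rhoQ_in : ¬ QuadHyperLiouville (Real.sqrt 2) ∧ QuadHyperLiouville rhoQ :=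
  ⟨not_quadHyperLiouville_sqrt_two, quadHyperLiouville_rhoQ⟩

end Exclusion
end Summit.Schanuel.Schanuel.Theorems.RootDecomp1BQuadFrame

end
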